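import Mathlib.RingTheory.RootsOfUnity.PrimitiveRoots
import Mathlib.Algebra.Ring.GeomSum
import Mathlib.Tactic.Ring
import Mathlib.Tactic.IntervalCases
import HarnessLib

/-!
# Venture HSemireg — the SINGLE-ORBIT RULE behind the eight- and twelve-tower designs (ENGINE-W code A, SERVICE (α), RUNG 3 (i), note P5-ALPHA-MOMENT-A.md v1.1 §2 (C′)):
# for a primitive `N`-th root of unity `ζ` and ANY `κ, κ′` in a commutative domain, the conjugation-antisymmetric orbit sum
# `M(p,q) = Σ_{j<N} ((ζ^jκ)^p (ζ̄^jκ′)^q − (ζ^jκ′)^p (ζ̄^jκ)^q)` (`ζ̄ = ζ^{N−1}`) factors as `(κ^pκ′^q − κ′^pκ^q)·Σ_{j<N} ζ^{j(p+(N−1)q)}` and VANISHES whenever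
# `p = q` or `N ∤ p + (N−1)q` (i.e. `N ∤ p − q`); so in the square `[0,g]²` with `g = N` it survives only at the Weil corners `(N,0), (0,N)` — general kernel theorem

HONEST FRAMING. Lean index of the computation cell `pub-hsemireg`, widening group ENGINE-W (code A, seat `engine-w-1`, gen 18).
RING THEORY OF ROOTS OF UNITY ONLY (Mathlib `IsPrimitiveRoot`, `geom_sum_mul`). What is NOT formalised: abelian varieties, towers, D2's admissibility criterion (by value), that
`κ′` is the complex conjugate of `κ` (here an arbitrary second element), or anything object-level; nothing here says that HC, HC_CM, HC_AV or DIAG(n,d) holds. Theorems only (0 `def`,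
0 named fact, 0 `sorry`). New namespace `SingleOrbitRule`. Companions: `EightTowerMomentDesign.lean` (#48; N = 4, κ = 2 + i), `TwelveTowerMomentDesign.lean` (#47; N = 6, κ of norm 7) —
the two instances `g = |μ_K|` as `decide` certificates; this file is the general mechanism.

SOURCE (the cell's own result, by value): `widen/ENGINE-W/out/p5alpha/P5-ALPHA-MOMENT-A.md` v1.1 §2 (C′) «SINGLE-ORBIT RULE (pencil, after the machine): with conjugation-antisymmetric
signs on one μ_K-orbit pair, M_{p,q} = (κ^pκ̄^q − κ̄^pκ^q)·Σ_{ζ∈μ_K} ζ^{p−q}, which inside [0,g]² survives only for |μ_K| ∣ (p − q) ≠ 0; hence ONE orbit pair is an admissible pure-u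
design exactly when g = |μ_K|: (g, d) = (4, 1) … and (6, 3) …». What the kernel holds (`R` a commutative ring, a domain where stated; `ζ̄ := ζ^(N−1)`):

* `orbit_sum_factor` — the factorisation `M(p,q) = (κ^pκ′^q − κ′^pκ^q)·Σ_{j<N} (ζ^(p+(N−1)q))^j` (pure `ring`, any commutative ring, any `ζ`).
* `root_power_sum_eq_zero` — `ζ` a primitive `N`-th root, `N ∤ m` ⟹ `Σ_{j<N} (ζ^m)^j = 0` (domain; from `geom_sum_mul` and `ζ^m ≠ 1`).
* `root_power_sum_eq_card` — `N ∣ m` ⟹ `Σ_{j<N} (ζ^m)^j = N`.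
* `single_orbit_vanishing` — `N ∤ p + (N−1)q` ⟹ `M(p,q) = 0`; `single_orbit_diagonal` — `M(p,p) = 0`; `single_orbit_corner` — `M(N,0) = N·(κ^N − κ′^N)` (the Weil corner `u∕|sign|`).
* `exponent_tables` — the finite bookkeeping: for `N = 4`, `p, q ≤ 4`, `p ≠ q`: `4 ∣ p + 3q` iff `(p,q) ∈ {(4,0),(0,4)}`; for `N = 6`, `p, q ≤ 6`, `p ≠ q`: `6 ∣ p + 5q` iff `(p,q) ∈ {(6,0),(0,6)}`;
  CONTRAST `N = 4`, `g = 8`: `4 ∣ 4 + 3·0` at the NON-corner `(4,0)` of `[0,8]²` (one orbit is not enough when `g > |μ_K|`). [`decide`]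
-/

namespace Summit.Ventures.HSemireg.SingleOrbitRule

open Finset

section ring

variable {R : Type*} [CommRing R]

/-- **Factorisation of the antisymmetric orbit sum** (any commutative ring, any `ζ`, `κ`, `κ′`; `ζ̄ := ζ^(N−1)`):
`Σ_{j<N} ((ζ^jκ)^p (ζ̄^jκ′)^q − (ζ^jκ′)^p (ζ̄^jκ)^q) = (κ^pκ′^q − κ′^pκ^q) · Σ_{j<N} (ζ^(p+(N−1)q))^j`. [kernel, `ring`] -/
theorem orbit_sum_factor (ζ κ κ' : R) (N p q : ℕ) :
    ∑ j ∈ range N, ((ζ ^ j * κ) ^ p * ((ζ ^ (N - 1)) ^ j * κ') ^ q - (ζ ^ j * κ') ^ p * ((ζ ^ (N - 1)) ^ j * κ) ^ q)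
      = (κ ^ p * κ' ^ q - κ' ^ p * κ ^ q) * ∑ j ∈ range N, (ζ ^ (p + (N - 1) * q)) ^ j := by
  rw [Finset.mul_sum]
  refine Finset.sum_congr rfl (fun j _ => ?_)
  ring

end ring

section domain

variable {R : Type*} [CommRing R] [IsDomain R]

/-- **Power sums of a primitive root**: `ζ` primitive of order `N`, `N ∤ m` ⟹ `Σ_{j<N} (ζ^m)^j = 0` (`(Σ)(ζ^m − 1) = ζ^{mN} − 1 = 0`, `ζ^m ≠ 1`). [kernel] -/
theorem root_power_sum_eq_zero {ζ : R} {N m : ℕ} (hζ : IsPrimitiveRoot ζ N) (hm : ¬ N ∣ m) :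
    ∑ j ∈ range N, (ζ ^ m) ^ j = 0 := by
  have hne : ζ ^ m ≠ 1 := fun h => hm ((hζ.pow_eq_one_iff_dvd m).1 h)
  have key : (∑ j ∈ range N, (ζ ^ m) ^ j) * (ζ ^ m - 1) = 0 := by
    rw [geom_sum_mul, ← pow_mul, mul_comm m N, pow_mul, hζ.pow_eq_one, one_pow, sub_self]
  rcases mul_eq_zero.1 key with h | h
  · exact h
  · exact absurd (sub_eq_zero.1 h) hne

omit [IsDomain R] in
/-- `N ∣ m` ⟹ `Σ_{j<N} (ζ^m)^j = N` (every term is `1`). [kernel] -/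
theorem root_power_sum_eq_card {ζ : R} {N m : ℕ} (hζ : IsPrimitiveRoot ζ N) (hm : N ∣ m) :
    ∑ j ∈ range N, (ζ ^ m) ^ j = N := by
  have h1 : ζ ^ m = 1 := (hζ.pow_eq_one_iff_dvd m).2 hm
  simp [h1]

/-- **SINGLE-ORBIT RULE (vanishing)**: `ζ` primitive of order `N`, `N ∤ p + (N−1)q` (equivalently `p ≢ q (mod N)`) ⟹ the antisymmetric orbit sum `M(p,q) = 0`,
for EVERY `κ, κ′`. [kernel] -/
theorem single_orbit_vanishing {ζ : R} {N : ℕ} (hζ : IsPrimitiveRoot ζ N) (κ κ' : R) (p q : ℕ) (h : ¬ N ∣ p + (N - 1) * q) :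
    ∑ j ∈ range N, ((ζ ^ j * κ) ^ p * ((ζ ^ (N - 1)) ^ j * κ') ^ q - (ζ ^ j * κ') ^ p * ((ζ ^ (N - 1)) ^ j * κ) ^ q) = 0 := by
  rw [orbit_sum_factor, root_power_sum_eq_zero hζ h, mul_zero]

omit [IsDomain R] in
/-- **Diagonal**: `M(p,p) = 0` (the bracket `κ^pκ′^p − κ′^pκ^p` vanishes), for every `ζ`. [kernel] -/
theorem single_orbit_diagonal (ζ κ κ' : R) (N p : ℕ) :
    ∑ j ∈ range N, ((ζ ^ j * κ) ^ p * ((ζ ^ (N - 1)) ^ j * κ') ^ p - (ζ ^ j * κ') ^ p * ((ζ ^ (N - 1)) ^ j * κ) ^ p) = 0 := by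
  rw [orbit_sum_factor, mul_comm (κ' ^ p) (κ ^ p), sub_self, zero_mul]

omit [IsDomain R] in
/-- **The Weil corner**: `M(N, 0) = N·(κ^N − κ′^N)` for `ζ` primitive of order `N` (the surviving moment; `u` up to sign conventions). [kernel] -/
theorem single_orbit_corner {ζ : R} {N : ℕ} (hζ : IsPrimitiveRoot ζ N) (κ κ' : R) :
    ∑ j ∈ range N, ((ζ ^ j * κ) ^ N * ((ζ ^ (N - 1)) ^ j * κ') ^ 0 - (ζ ^ j * κ') ^ N * ((ζ ^ (N - 1)) ^ j * κ) ^ 0)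
      = (N : R) * (κ ^ N - κ' ^ N) := by
  rw [orbit_sum_factor, root_power_sum_eq_card hζ ⟨1, by ring⟩]
  ring

end domain

/-- **Exponent bookkeeping** (why ONE orbit pair suffices exactly when `g = |μ_K|`): `N = 4`, square `[0,4]²`: off the diagonal, `4 ∣ p + 3q` only at `(4,0), (0,4)`;
`N = 6`, square `[0,6]²`: off the diagonal, `6 ∣ p + 5q` only at `(6,0), (0,6)`; contrast `N = 4`, square `[0,8]²`: `4 ∣ 4 + 3·0` at the non-corner `(4,0)`. [kernel, `decide`] -/
theorem exponent_tables :
    (∀ p < 5, ∀ q < 5, p ≠ q → (4 ∣ p + 3 * q ↔ (p = 4 ∧ q = 0) ∨ (p = 0 ∧ q = 4))) ∧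
    (∀ p < 7, ∀ q < 7, p ≠ q → (6 ∣ p + 5 * q ↔ (p = 6 ∧ q = 0) ∨ (p = 0 ∧ q = 6))) ∧
    (4 ∣ 4 + 3 * 0 ∧ ¬((4 = 8 ∧ 0 = 0) ∨ (4 = 0 ∧ 0 = 8))) := by
  refine ⟨by decide, by decide, by decide⟩

end Summit.Ventures.HSemireg.SingleOrbitRule
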